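import Literature.NumberTheory.Automorphic.SatakeTransformGL
import Literature.NumberTheory.Automorphic.CartanDecompositionGLnPowers
import Mathlib.Data.Matrix.Block
import HarnessLib

/-!
# The parabolic blocks `[[g, x], [0, c]] ∈ GL_{n+1}(F)` and the fibration of the integral cosets
# of `GL_{n+1}(F)/GL_{n+1}(𝒪)` over those of `GL_n(F)/GL_n(𝒪)`

Topic `NumberTheory/Automorphic`; theorems and definitions with bodies only (no named fact).
Setting: a field `F` with a `ValuativeRel` whose valuation ring `𝒪 = 𝒪[F]` is a discrete valuation
ring, a uniformizing element `ϖ` (`IsUniformizingElement`), `K_n = GL_n(𝒪) = glInt n F`.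

* `blockSuccMatrix A x c = [[A, x], [0, c]] ∈ M_{n+1}(R)` (`Matrix.fromBlocks` reindexed by
  `finSumFinEquiv`: the `A`-block on `Fin.castSucc`, the corner at `Fin.last n`), its entries,
  determinant `det A · c` and product rule
  `[[A, x], [0, c]] [[B, y], [0, d]] = [[AB, Ay + d x], [0, cd]]`; `blockSuccGL g x c ∈ GL_{n+1}(F)`.
* Compatibility with the groups of the Iwasawa decomposition: `blockSuccGL u x 1 ∈ U_{n+1}` for
  `u ∈ U_n`, `blockSuccGL (ϖ^e) 0 (ϖ^m) = ϖ^{(e, m)}` (`Fin.snoc`), `blockSuccGL g x c ∈ K_{n+1}`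
  for `g ∈ K_n`, `x` integral, `|c| = 1`; hence the **Iwasawa exponent**
  `e([[g, x], [0, ϖ^m]]) = (e(g), m)` (`iwasawaExp_blockSuccGL`) and the **weight rule**
  `⟨ν_{n+1}, (e, m)⟩ = ⟨ν_n, e⟩ + ∑ e` (`satakeTwistExp_snoc`) for the twisting exponent of
  `SatakeTransformGL`.
* **Fibration of the integral cosets** (`exists_eq_blockSuccGL_mul`): every integral
  `h ∈ GL_{n+1}(F)` is `[[g, x], [0, ϖ^m]] k` with `g ∈ GL_n(F)` integral, `x ∈ 𝒪ⁿ`, `m ≥ 0`,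
  `k ∈ K_{n+1}` — in lattice terms `M = h 𝒪^{n+1}` is determined by `M' = M ∩ 𝒪ⁿ = g 𝒪ⁿ`, the
  ideal `ϖ^m 𝒪` = last coordinates of `M`, and a class `x mod M'`; and the **uniqueness** statement
  `blockSuccGL_inv_mul_blockSuccGL_mem_glInt_iff`:
  `[[g, x], [0, ϖ^m]] K = [[g', x'], [0, ϖ^{m'}]] K ⇔ g K_n = g' K_n ∧ m = m' ∧ g⁻¹(x' - x) ∈ 𝒪ⁿ`.
  This is the coset form of the recursion over the last column used to count lattices in
  `𝒪^{n+1}` by their intersections with `𝒪ⁿ` (Macdonald, *Symmetric functions and Hall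
  polynomials* (1995), Ch. II, §4 and Ch. V, (2.6)–(2.9): sublattices and their types; the
  "parabolic descent" `GL_{n+1} ⊃ P_{(n,1)} ↠ GL_n × GL_1` of the Satake transform, Cartier,
  Corvallis 1979, §IV.2), written so that no transversal is needed downstream.

## References

* I. G. Macdonald, *Symmetric functions and Hall polynomials*, 2nd ed. (1995), Ch. V, §2
  [Macdonald1995].
* P. Cartier, *Representations of 𝔭-adic groups: a survey*, Proc. Sympos. Pure Math. 33 (1979),
  part 1, §IV.2 [CartierCorvallis1979].
-/

noncomputable section

open scoped MatrixGroups
open ValuativeRel Matrix Finset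

namespace Literature.NumberTheory.Automorphic

/-! ### The block matrix `[[A, x], [0, c]]` -/

section Matrix

variable {R : Type*} [CommRing R] {n : ℕ}

/-- The block matrix `[[A, x], [0, c]] ∈ M_{n+1}(R)`: `A` on the indices `Fin.castSucc`, the
column `x` in the last column, `c` in the corner and zeros in the rest of the last row
(`Matrix.fromBlocks` reindexed by `finSumFinEquiv : Fin n ⊕ Fin 1 ≃ Fin (n+1)`). [folklore] -/
def blockSuccMatrix (A : Matrix (Fin n) (Fin n) R) (x : Fin n → R) (c : R) :
    Matrix (Fin (n + 1)) (Fin (n + 1)) R :=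
  Matrix.reindex finSumFinEquiv finSumFinEquiv
    (Matrix.fromBlocks A (Matrix.of fun i (_ : Fin 1) => x i) 0 (Matrix.of fun (_ _ : Fin 1) => c))

/-- Upper-left entries of `[[A, x], [0, c]]`. [folklore] -/
@[simp]
theorem blockSuccMatrix_apply_castSucc_castSucc (A : Matrix (Fin n) (Fin n) R) (x : Fin n → R)
    (c : R) (i j : Fin n) : blockSuccMatrix A x c i.castSucc j.castSucc = A i j := by
  simp [blockSuccMatrix]

/-- Last-column entries of `[[A, x], [0, c]]`. [folklore] -/
@[simp]
theorem blockSuccMatrix_apply_castSucc_last (A : Matrix (Fin n) (Fin n) R) (x : Fin n → R)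
    (c : R) (i : Fin n) : blockSuccMatrix A x c i.castSucc (Fin.last n) = x i := by
  simp [blockSuccMatrix]

/-- Last-row entries of `[[A, x], [0, c]]` left of the corner vanish. [folklore] -/
@[simp]
theorem blockSuccMatrix_apply_last_castSucc (A : Matrix (Fin n) (Fin n) R) (x : Fin n → R)
    (c : R) (j : Fin n) : blockSuccMatrix A x c (Fin.last n) j.castSucc = 0 := by
  simp [blockSuccMatrix]

/-- The corner entry of `[[A, x], [0, c]]`. [folklore] -/
@[simp]
theorem blockSuccMatrix_apply_last_last (A : Matrix (Fin n) (Fin n) R) (x : Fin n → R) (c : R) :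
    blockSuccMatrix A x c (Fin.last n) (Fin.last n) = c := by
  simp [blockSuccMatrix]

/-- `det [[A, x], [0, c]] = det A · c`. [folklore] -/
theorem det_blockSuccMatrix (A : Matrix (Fin n) (Fin n) R) (x : Fin n → R) (c : R) :
    (blockSuccMatrix A x c).det = A.det * c := by
  rw [blockSuccMatrix, Matrix.det_reindex_self, Matrix.det_fromBlocks_zero₂₁]
  congr 1
  rw [Matrix.det_unique]
  rfl

/-- `[[1, 0], [0, 1]] = 1`. [folklore] -/
@[simp]
theorem blockSuccMatrix_one_zero_one : blockSuccMatrix (1 : Matrix (Fin n) (Fin n) R) 0 1 = 1 := by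
  ext i j
  rcases Fin.eq_castSucc_or_eq_last i with ⟨i, rfl⟩ | rfl <;>
    rcases Fin.eq_castSucc_or_eq_last j with ⟨j, rfl⟩ | rfl
  · rw [blockSuccMatrix_apply_castSucc_castSucc, Matrix.one_apply, Matrix.one_apply]
    simp [Fin.castSucc_inj]
  · rw [blockSuccMatrix_apply_castSucc_last, Pi.zero_apply, Matrix.one_apply_ne
      (Fin.castSucc_lt_last i).ne]
  · rw [blockSuccMatrix_apply_last_castSucc, Matrix.one_apply_ne (Fin.castSucc_lt_last j).ne']
  · rw [blockSuccMatrix_apply_last_last, Matrix.one_apply_eq]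

/-- **Product rule** `[[A, x], [0, c]] [[B, y], [0, d]] = [[AB, Ay + d x], [0, cd]]`. [folklore] -/
theorem blockSuccMatrix_mul (A B : Matrix (Fin n) (Fin n) R) (x y : Fin n → R) (c d : R) :
    blockSuccMatrix A x c * blockSuccMatrix B y d =
      blockSuccMatrix (A * B) (A *ᵥ y + d • x) (c * d) := by
  ext i j
  rw [Matrix.mul_apply, Fin.sum_univ_castSucc]
  rcases Fin.eq_castSucc_or_eq_last i with ⟨i, rfl⟩ | rfl <;>
    rcases Fin.eq_castSucc_or_eq_last j with ⟨j, rfl⟩ | rfl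
  · simp [Matrix.mul_apply]
  · simp [Matrix.mulVec, dotProduct, mul_comm d]
  · simp
  · simp

/-- A matrix whose last row is `(0, …, 0, c)` is a block matrix `[[A, x], [0, c]]`. [folklore] -/
theorem eq_blockSuccMatrix_of_apply_last_castSucc (M : Matrix (Fin (n + 1)) (Fin (n + 1)) R)
    (h : ∀ j : Fin n, M (Fin.last n) j.castSucc = 0) :
    M = blockSuccMatrix (M.submatrix Fin.castSucc Fin.castSucc) (fun i => M i.castSucc (Fin.last n))
      (M (Fin.last n) (Fin.last n)) := by
  ext i j
  rcases Fin.eq_castSucc_or_eq_last i with ⟨i, rfl⟩ | rfl <;>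
    rcases Fin.eq_castSucc_or_eq_last j with ⟨j, rfl⟩ | rfl
  · rw [blockSuccMatrix_apply_castSucc_castSucc, Matrix.submatrix_apply]
  · rw [blockSuccMatrix_apply_castSucc_last]
  · rw [blockSuccMatrix_apply_last_castSucc, h]
  · rw [blockSuccMatrix_apply_last_last]

/-- **Action on vectors**: `[[A, x], [0, c]] (z, t) = (A z + t x, c t)` (`Fin.snoc`). [folklore] -/
theorem blockSuccMatrix_mulVec_snoc (A : Matrix (Fin n) (Fin n) R) (x : Fin n → R) (c : R)
    (z : Fin n → R) (t : R) :
    blockSuccMatrix A x c *ᵥ Fin.snoc (α := fun _ => R) z t =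
      Fin.snoc (α := fun _ => R) (A *ᵥ z + t • x) (c * t) := by
  funext i
  rw [Matrix.mulVec, dotProduct, Fin.sum_univ_castSucc]
  rcases Fin.eq_castSucc_or_eq_last i with ⟨i, rfl⟩ | rfl
  · simp [Matrix.mulVec, dotProduct, mul_comm t]
  · simp

/-- Naturality of `[[A, x], [0, c]]` in the ring. [folklore] -/
theorem blockSuccMatrix_map {S : Type*} [CommRing S] (f : R →+* S) (A : Matrix (Fin n) (Fin n) R)
    (x : Fin n → R) (c : R) :
    (blockSuccMatrix A x c).map f = blockSuccMatrix (A.map f) (f ∘ x) (f c) := by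
  ext i j
  rcases Fin.eq_castSucc_or_eq_last i with ⟨i, rfl⟩ | rfl <;>
    rcases Fin.eq_castSucc_or_eq_last j with ⟨j, rfl⟩ | rfl
  · rw [Matrix.map_apply, blockSuccMatrix_apply_castSucc_castSucc,
      blockSuccMatrix_apply_castSucc_castSucc, Matrix.map_apply]
  · rw [Matrix.map_apply, blockSuccMatrix_apply_castSucc_last, blockSuccMatrix_apply_castSucc_last,
      Function.comp_apply]
  · rw [Matrix.map_apply, blockSuccMatrix_apply_last_castSucc, blockSuccMatrix_apply_last_castSucc,
      map_zero]
  · rw [Matrix.map_apply, blockSuccMatrix_apply_last_last, blockSuccMatrix_apply_last_last]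

/-- An upper triangular matrix has last row `(0, …, 0, *)`. [folklore] -/
theorem apply_last_castSucc_eq_zero_of_blockTriangular {M : Matrix (Fin (n + 1)) (Fin (n + 1)) R}
    (hM : M.BlockTriangular id) (j : Fin n) : M (Fin.last n) j.castSucc = 0 :=
  hM (Fin.castSucc_lt_last j)

end Matrix

/-! ### The block in `GL_{n+1}(F)` -/

section GLBlock

variable {F : Type*} [Field F] {n : ℕ}

/-- `[[g, x], [0, c]] ∈ GL_{n+1}(F)` for `g ∈ GL_n(F)` and `c ∈ Fˣ`. [folklore] -/
def blockSuccGL (g : GL (Fin n) F) (x : Fin n → F) (c : Fˣ) : GL (Fin (n + 1)) F :=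
  Matrix.GeneralLinearGroup.mkOfDetNeZero (blockSuccMatrix (g : Matrix (Fin n) (Fin n) F) x c) (by
    rw [det_blockSuccMatrix]
    exact mul_ne_zero (Matrix.GeneralLinearGroup.det_ne_zero g) c.ne_zero)

/-- The matrix of `blockSuccGL g x c`. [folklore] -/
@[simp]
theorem coe_blockSuccGL (g : GL (Fin n) F) (x : Fin n → F) (c : Fˣ) :
    ((blockSuccGL g x c : GL (Fin (n + 1)) F) : Matrix (Fin (n + 1)) (Fin (n + 1)) F) =
      blockSuccMatrix (g : Matrix (Fin n) (Fin n) F) x c := rfl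

/-- Product rule in `GL_{n+1}(F)`. [folklore] -/
theorem blockSuccGL_mul (g g' : GL (Fin n) F) (x x' : Fin n → F) (c c' : Fˣ) :
    blockSuccGL g x c * blockSuccGL g' x' c' =
      blockSuccGL (g * g') ((g : Matrix (Fin n) (Fin n) F) *ᵥ x' + (c' : F) • x) (c * c') :=
  Units.ext (by
    rw [Units.val_mul, coe_blockSuccGL, coe_blockSuccGL, coe_blockSuccGL, blockSuccMatrix_mul]
    rfl)

/-- `[[1, 0], [0, 1]] = 1`. [folklore] -/
@[simp]
theorem blockSuccGL_one : blockSuccGL (1 : GL (Fin n) F) 0 1 = 1 :=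
  Units.ext (by rw [coe_blockSuccGL, Units.val_one, Units.val_one, blockSuccMatrix_one_zero_one,
    Units.val_one])

/-- The inverse of `[[g, x], [0, c]]` is `[[g⁻¹, -c⁻¹ g⁻¹ x], [0, c⁻¹]]`. [folklore] -/
theorem blockSuccGL_inv (g : GL (Fin n) F) (x : Fin n → F) (c : Fˣ) :
    (blockSuccGL g x c)⁻¹ =
      blockSuccGL g⁻¹ (-((c⁻¹ : Fˣ) : F) • (((g⁻¹ : GL (Fin n) F) : Matrix (Fin n) (Fin n) F) *ᵥ x))
        c⁻¹ := by
  rw [inv_eq_iff_mul_eq_one, blockSuccGL_mul, mul_inv_cancel, mul_inv_cancel, ← blockSuccGL_one]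
  congr 1
  rw [Matrix.mulVec_smul, Matrix.mulVec_mulVec, ← Units.val_mul, mul_inv_cancel, Units.val_one,
    Matrix.one_mulVec, neg_smul, neg_add_cancel]

/-- `[[g, x], [0, c]]⁻¹ [[g', x'], [0, c']] = [[g⁻¹ g', g⁻¹ x' - (c'/c) g⁻¹ x], [0, c'/c]]`.
[folklore] -/
theorem blockSuccGL_inv_mul_blockSuccGL (g g' : GL (Fin n) F) (x x' : Fin n → F) (c c' : Fˣ) :
    (blockSuccGL g x c)⁻¹ * blockSuccGL g' x' c' =
      blockSuccGL (g⁻¹ * g') ((((g⁻¹ : GL (Fin n) F) : Matrix (Fin n) (Fin n) F) *ᵥ x') -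
        ((c⁻¹ * c' : Fˣ) : F) • (((g⁻¹ : GL (Fin n) F) : Matrix (Fin n) (Fin n) F) *ᵥ x))
        (c⁻¹ * c') := by
  rw [blockSuccGL_inv, blockSuccGL_mul]
  congr 1
  rw [smul_smul, mul_neg, neg_smul, mul_comm (c' : F), Units.val_mul, sub_eq_add_neg]

variable [ValuativeRel F]

/-- **Integrality of a block**: `[[A, x], [0, c]]` is integral iff `A`, `x` and `c` are. [folklore] -/
theorem isIntegralMatrix_blockSuccMatrix_iff {A : Matrix (Fin n) (Fin n) F} {x : Fin n → F} {c : F} :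
    IsIntegralMatrix (blockSuccMatrix A x c) ↔
      IsIntegralMatrix A ∧ (∀ i, x i ∈ 𝒪[F]) ∧ c ∈ 𝒪[F] := by
  constructor
  · intro h
    refine ⟨fun i j => ?_, fun i => ?_, ?_⟩
    · have := h i.castSucc j.castSucc
      rwa [blockSuccMatrix_apply_castSucc_castSucc] at this
    · have := h i.castSucc (Fin.last n)
      rwa [blockSuccMatrix_apply_castSucc_last] at this
    · have := h (Fin.last n) (Fin.last n)
      rwa [blockSuccMatrix_apply_last_last] at this
  · rintro ⟨hA, hx, hc⟩ i j
    rcases Fin.eq_castSucc_or_eq_last i with ⟨i, rfl⟩ | rfl <;>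
      rcases Fin.eq_castSucc_or_eq_last j with ⟨j, rfl⟩ | rfl
    · rw [blockSuccMatrix_apply_castSucc_castSucc]; exact hA i j
    · rw [blockSuccMatrix_apply_castSucc_last]; exact hx i
    · rw [blockSuccMatrix_apply_last_castSucc]; exact Subring.zero_mem _
    · rw [blockSuccMatrix_apply_last_last]; exact hc

/-- `[[g, x], [0, c]] ∈ K_{n+1}` for `g ∈ K_n`, `x` integral and `|c| = 1`. [folklore] -/
theorem blockSuccGL_mem_glInt {g : GL (Fin n) F} (hg : g ∈ glInt n F) {x : Fin n → F}
    (hx : ∀ i, x i ∈ 𝒪[F]) {c : Fˣ} (hc : valuation F (c : F) = 1) :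
    blockSuccGL g x c ∈ glInt (n + 1) F := by
  refine mem_glInt_of_isIntegralMatrix ?_ ?_
  · rw [coe_blockSuccGL, isIntegralMatrix_blockSuccMatrix_iff]
    exact ⟨isIntegralMatrix_of_mem_glInt hg, hx, (Valuation.mem_integer_iff _ _).2 hc.le⟩
  · rw [coe_blockSuccGL, det_blockSuccMatrix, map_mul, valuation_det_eq_one_of_mem_glInt hg, hc,
      one_mul]

/-- **Membership of a block in `K_{n+1}`**: `[[g, x], [0, c]] ∈ K_{n+1}` iff `g ∈ K_n`, `x` is
integral and `|c| = 1` (its inverse is `[[g⁻¹, -c⁻¹g⁻¹x], [0, c⁻¹]]`). [folklore] -/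
theorem blockSuccGL_mem_glInt_iff {g : GL (Fin n) F} {x : Fin n → F} {c : Fˣ} :
    blockSuccGL g x c ∈ glInt (n + 1) F ↔
      g ∈ glInt n F ∧ (∀ i, x i ∈ 𝒪[F]) ∧ valuation F (c : F) = 1 := by
  refine ⟨fun h => ?_, fun h => blockSuccGL_mem_glInt h.1 h.2.1 h.2.2⟩
  have h1 := isIntegralMatrix_of_mem_glInt h
  have h2 := isIntegralMatrix_inv_of_mem_glInt h
  rw [coe_blockSuccGL, isIntegralMatrix_blockSuccMatrix_iff] at h1
  rw [blockSuccGL_inv, coe_blockSuccGL, isIntegralMatrix_blockSuccMatrix_iff] at h2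
  refine ⟨(mem_glInt_iff g).2 ⟨h1.1, h2.1⟩, h1.2.1, le_antisymm ((Valuation.mem_integer_iff _ _).1
    h1.2.2) ?_⟩
  have h3 := (Valuation.mem_integer_iff _ _).1 h2.2.2
  rw [Units.val_inv_eq_inv_val, map_inv₀] at h3
  exact (inv_le_one₀ ((Valuation.pos_iff _).2 c.ne_zero)).1 h3

omit [ValuativeRel F] in
/-- `[[u, x], [0, 1]] ∈ U_{n+1}` for `u ∈ U_n`. [folklore] -/
theorem blockSuccGL_mem_upperUnitriangular {u : GL (Fin n) F}
    (hu : u ∈ upperUnitriangular (Fin n) F) (x : Fin n → F) :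
    blockSuccGL u x 1 ∈ upperUnitriangular (Fin (n + 1)) F := by
  rw [mem_upperUnitriangular_iff] at hu ⊢
  refine ⟨fun i j hij => ?_, fun i => ?_⟩
  · rcases Fin.eq_castSucc_or_eq_last i with ⟨i, rfl⟩ | rfl <;>
      rcases Fin.eq_castSucc_or_eq_last j with ⟨j, rfl⟩ | rfl
    · rw [coe_blockSuccGL, blockSuccMatrix_apply_castSucc_castSucc]
      exact hu.1 (Fin.castSucc_lt_castSucc_iff.1 hij)
    · exact absurd hij (not_lt.2 (Fin.castSucc_lt_last i).le)
    · rw [coe_blockSuccGL, blockSuccMatrix_apply_last_castSucc]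
    · exact absurd hij (lt_irrefl _)
  · rcases Fin.eq_castSucc_or_eq_last i with ⟨i, rfl⟩ | rfl
    · rw [coe_blockSuccGL, blockSuccMatrix_apply_castSucc_castSucc]; exact hu.2 i
    · rw [coe_blockSuccGL, blockSuccMatrix_apply_last_last, Units.val_one]

omit [ValuativeRel F] in
/-- `[[ϖ^e, 0], [0, ϖ^m]] = ϖ^{(e, m)}` (`Fin.snoc`). [folklore] -/
theorem blockSuccGL_zpowDiagGL {ϖ : F} (hϖ : ϖ ≠ 0) (e : Fin n → ℤ) (m : ℤ) :
    blockSuccGL (zpowDiagGL hϖ e) 0 (Units.mk0 ϖ hϖ ^ m) =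
      zpowDiagGL hϖ (Fin.snoc (α := fun _ => ℤ) e m) := by
  refine Units.ext (Matrix.ext fun i j => ?_)
  rw [coe_blockSuccGL, coe_zpowDiagGL, coe_zpowDiagGL]
  rcases Fin.eq_castSucc_or_eq_last i with ⟨i, rfl⟩ | rfl <;>
    rcases Fin.eq_castSucc_or_eq_last j with ⟨j, rfl⟩ | rfl
  · rw [blockSuccMatrix_apply_castSucc_castSucc, Matrix.diagonal_apply, Matrix.diagonal_apply]
    simp only [Fin.castSucc_inj, Fin.snoc_castSucc]
  · rw [blockSuccMatrix_apply_castSucc_last, Pi.zero_apply,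
      Matrix.diagonal_apply_ne _ (Fin.castSucc_lt_last i).ne]
  · rw [blockSuccMatrix_apply_last_castSucc, Matrix.diagonal_apply_ne _ (Fin.castSucc_lt_last j).ne']
  · rw [blockSuccMatrix_apply_last_last, Matrix.diagonal_apply_eq, Fin.snoc_last,
      Units.val_zpow_eq_zpow_val, Units.val_mk0]

/-- `[[k, 0], [0, 1]] ∈ K_{n+1}` for `k ∈ K_n`. [folklore] -/
theorem blockSuccGL_zero_one_mem_glInt {k : GL (Fin n) F} (hk : k ∈ glInt n F) :
    blockSuccGL k 0 1 ∈ glInt (n + 1) F :=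
  blockSuccGL_mem_glInt hk (fun _ => Subring.zero_mem _) (by rw [Units.val_one, map_one])

/-! ### Iwasawa exponents and weights of blocks -/

section Iwasawa

variable [IsDiscreteValuationRing 𝒪[F]] {ϖ : F} (hϖ : IsUniformizingElement ϖ)
include hϖ

/-- **The Iwasawa exponent of a block**: `e([[g, x], [0, ϖ^m]]) = (e(g), m)`: if `g = u ϖ^e k`
then `[[g, x], [0, ϖ^m]] = [[u, ϖ^{-m} x], [0, 1]] · [[ϖ^e, 0], [0, ϖ^m]] · [[k, 0], [0, 1]]`.
[folklore] -/
theorem iwasawaExp_blockSuccGL (g : GL (Fin n) F) (x : Fin n → F) (m : ℤ) :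
    iwasawaExp hϖ (blockSuccGL g x (Units.mk0 ϖ hϖ.ne_zero ^ m)) =
      Fin.snoc (α := fun _ => ℤ) (iwasawaExp hϖ g) m := by
  obtain ⟨u, hu, k, hk, h⟩ := iwasawaExp_spec hϖ g
  set e := iwasawaExp hϖ g with he
  have hU := blockSuccGL_mem_upperUnitriangular hu
    ((((Units.mk0 ϖ hϖ.ne_zero ^ m)⁻¹ : Fˣ) : F) • x)
  refine iwasawaExp_eq hϖ hU (blockSuccGL_zero_one_mem_glInt hk) ?_
  rw [← blockSuccGL_zpowDiagGL, blockSuccGL_mul, blockSuccGL_mul, one_mul, mul_one, Matrix.mulVec_zero,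
    zero_add, Matrix.mulVec_zero, zero_add, Units.val_one, one_smul, smul_smul, ← Units.val_mul,
    mul_inv_cancel, Units.val_one, one_smul, ← h]

omit [IsDiscreteValuationRing 𝒪[F]] hϖ in
/-- **The weight rule** `⟨ν_{n+1}, (e, m)⟩ = ⟨ν_n, e⟩ + ∑ e` for the twisting exponent
`⟨ν_N, e⟩ = ∑ (N - 1 - i) e_i` of `SatakeTransformGL` (`ν_{n+1} = (n, n-1, …, 1, 0)` restricts to
`ν_n + (1, …, 1)` and vanishes on the last coordinate). [folklore] -/
theorem satakeTwistExp_snoc (e : Fin n → ℤ) (m : ℤ) :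
    satakeTwistExp (Fin.snoc (α := fun _ => ℤ) e m) = satakeTwistExp e + ∑ i, e i := by
  rw [satakeTwistExp, satakeTwistExp, Fin.sum_univ_castSucc, Fin.snoc_last, ← Finset.sum_add_distrib]
  have hlast : (((n + 1 : ℕ) : ℤ) - 1 - ((Fin.last n : Fin (n + 1)) : ℕ)) * m = 0 := by
    rw [Fin.val_last]; push_cast; ring
  rw [hlast, add_zero]
  refine Finset.sum_congr rfl fun i _ => ?_
  rw [Fin.snoc_castSucc, Fin.val_castSucc]
  push_cast
  ring

end Iwasawa

/-! ### The fibration of the integral cosets over the last column -/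

section Fibration

variable [IsDiscreteValuationRing 𝒪[F]] {ϖ : F} (hϖ : IsUniformizingElement ϖ)
include hϖ

omit [IsDiscreteValuationRing 𝒪[F]] in
/-- `ϖ^d ∈ 𝒪` forces `d ≥ 0`. [folklore] -/
theorem IsUniformizingElement.nonneg_of_zpow_mem {d : ℤ} (h : ϖ ^ d ∈ 𝒪[F]) : 0 ≤ d := by
  by_contra hd
  rw [not_le] at hd
  apply hϖ.inv_not_mem
  have : ϖ⁻¹ = ϖ ^ d * ϖ ^ ((-d - 1).toNat) := by
    rw [← zpow_natCast, Int.toNat_of_nonneg (by omega), ← zpow_add₀ hϖ.ne_zero,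
      show d + (-d - 1) = -1 by ring, _root_.zpow_neg_one]
  rw [this]
  exact Subring.mul_mem _ h (hϖ.pow_mem _)

/-- **Fibration of the integral cosets of `GL_{n+1}` (existence).** Every integral
`h ∈ GL_{n+1}(F)` factors as `h = [[g, x], [0, ϖ^m]] · k` with `g ∈ GL_n(F)` integral, `x ∈ 𝒪ⁿ`,
`m ∈ ℕ` and `k ∈ K_{n+1} = GL_{n+1}(𝒪)` — from the Iwasawa decomposition `h = u ϖ^E κ`, whose
Borel part `u ϖ^E` has last row `(0, …, 0, ϖ^{E_n})` (Macdonald (1995), Ch. V, §2: a sublattice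
`M ⊆ 𝒪^{n+1}` is determined by `M ∩ 𝒪ⁿ`, its last coordinates `ϖ^m 𝒪` and a class modulo
`M ∩ 𝒪ⁿ`). [folklore] -/
theorem exists_eq_blockSuccGL_mul {h : GL (Fin (n + 1)) F}
    (hh : IsIntegralMatrix (h : Matrix (Fin (n + 1)) (Fin (n + 1)) F)) :
    ∃ g : GL (Fin n) F, IsIntegralMatrix (g : Matrix (Fin n) (Fin n) F) ∧
      ∃ x : Fin n → F, (∀ i, x i ∈ 𝒪[F]) ∧ ∃ m : ℕ, ∃ k ∈ glInt (n + 1) F,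
        h = blockSuccGL g x (Units.mk0 ϖ hϖ.ne_zero ^ (m : ℤ)) * k := by
  obtain ⟨u, hu, k, hk, hE⟩ := iwasawaExp_spec hϖ h
  set E := iwasawaExp hϖ h with hEdef
  set P : GL (Fin (n + 1)) F := u * zpowDiagGL hϖ.ne_zero E with hP
  -- `P = h k⁻¹` is integral with last row `(0, …, 0, ϖ^{E_n})`
  have hPh : P = h * k⁻¹ := by rw [hE, mul_inv_cancel_right]
  have hPint : IsIntegralMatrix (P : Matrix (Fin (n + 1)) (Fin (n + 1)) F) := by
    rw [hPh, Units.val_mul]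
    exact hh.mul (isIntegralMatrix_inv_of_mem_glInt hk)
  have hrow : ∀ j : Fin n, (P : Matrix (Fin (n + 1)) (Fin (n + 1)) F) (Fin.last n) j.castSucc = 0 := by
    intro j
    rw [hP, Units.val_mul, coe_zpowDiagGL, Matrix.mul_diagonal,
      apply_last_castSucc_eq_zero_of_blockTriangular ((mem_upperUnitriangular_iff u).1 hu).1, zero_mul]
  have hcorner : (P : Matrix (Fin (n + 1)) (Fin (n + 1)) F) (Fin.last n) (Fin.last n) =
      ϖ ^ E (Fin.last n) := by
    rw [hP, Units.val_mul, coe_zpowDiagGL, Matrix.mul_diagonal,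
      ((mem_upperUnitriangular_iff u).1 hu).2, one_mul]
  have hblock := eq_blockSuccMatrix_of_apply_last_castSucc _ hrow
  rw [hcorner] at hblock
  -- the upper-left block is invertible
  set A := (P : Matrix (Fin (n + 1)) (Fin (n + 1)) F).submatrix Fin.castSucc Fin.castSucc with hA
  have hdetA : A.det ≠ 0 := by
    intro h0
    apply Matrix.GeneralLinearGroup.det_ne_zero P
    rw [hblock, det_blockSuccMatrix, h0, zero_mul]
  set g : GL (Fin n) F := Matrix.GeneralLinearGroup.mkOfDetNeZero A hdetA with hg
  set x : Fin n → F := fun i => (P : Matrix (Fin (n + 1)) (Fin (n + 1)) F) i.castSucc (Fin.last n)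
    with hx
  have hPeq : P = blockSuccGL g x (Units.mk0 ϖ hϖ.ne_zero ^ E (Fin.last n)) :=
    Units.ext (by rw [coe_blockSuccGL, Units.val_zpow_eq_zpow_val, Units.val_mk0]; exact hblock)
  -- integrality of the pieces, `E_n ≥ 0`
  have hint := hPint
  rw [hPeq, coe_blockSuccGL, isIntegralMatrix_blockSuccMatrix_iff, Units.val_zpow_eq_zpow_val,
    Units.val_mk0] at hint
  obtain ⟨hgint, hxint, hcint⟩ := hint
  have hm := hϖ.nonneg_of_zpow_mem hcint
  refine ⟨g, hgint, x, hxint, (E (Fin.last n)).toNat, k, hk, ?_⟩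
  rw [Int.toNat_of_nonneg hm, ← hPeq, hPh, inv_mul_cancel_right]

omit [IsDiscreteValuationRing 𝒪[F]] in
/-- `|ϖ^d| = 1` iff `d = 0`. [folklore] -/
theorem IsUniformizingElement.valuation_zpow_eq_one_iff {d : ℤ} :
    valuation F (ϖ ^ d) = 1 ↔ d = 0 := by
  refine ⟨fun h => ?_, fun h => by rw [h, zpow_zero, map_one]⟩
  refine hϖ.eq_zero_of_zpow_mem ((Valuation.mem_integer_iff _ _).2 h.le)
    ((Valuation.mem_integer_iff _ _).2 ?_)
  rw [_root_.zpow_neg, map_inv₀, h, inv_one]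

omit [IsDiscreteValuationRing 𝒪[F]] in
/-- **Fibration of the integral cosets of `GL_{n+1}` (uniqueness).**
`[[g, x], [0, ϖ^m]] K_{n+1} = [[g', x'], [0, ϖ^{m'}]] K_{n+1}` iff `g K_n = g' K_n`, `m = m'` and
`g⁻¹ (x' - x) ∈ 𝒪ⁿ` (i.e. `x ≡ x'` modulo the lattice `g 𝒪ⁿ`). [folklore] -/
theorem blockSuccGL_inv_mul_blockSuccGL_mem_glInt_iff {g g' : GL (Fin n) F} {x x' : Fin n → F}
    {m m' : ℤ} :
    (blockSuccGL g x (Units.mk0 ϖ hϖ.ne_zero ^ m))⁻¹ *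
        blockSuccGL g' x' (Units.mk0 ϖ hϖ.ne_zero ^ m') ∈ glInt (n + 1) F ↔
      g⁻¹ * g' ∈ glInt n F ∧ m = m' ∧
        ∀ i, ((((g⁻¹ : GL (Fin n) F) : Matrix (Fin n) (Fin n) F) *ᵥ (x' - x)) i ∈ 𝒪[F]) := by
  rw [blockSuccGL_inv_mul_blockSuccGL, blockSuccGL_mem_glInt_iff, ← _root_.zpow_neg,
    ← _root_.zpow_add, Units.val_zpow_eq_zpow_val, Units.val_mk0, hϖ.valuation_zpow_eq_one_iff,
    show -m + m' = 0 ↔ m = m' by omega]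
  refine and_congr_right fun _ => ⟨fun ⟨hx, hm⟩ => ⟨hm, ?_⟩, fun ⟨hm, hx⟩ => ⟨?_, hm⟩⟩
  · subst hm
    intro i
    have := hx i
    rwa [neg_add_cancel, zpow_zero, one_smul, ← Matrix.mulVec_sub] at this
  · subst hm
    intro i
    rw [neg_add_cancel, zpow_zero, one_smul, ← Matrix.mulVec_sub]
    exact hx i

omit [IsDiscreteValuationRing 𝒪[F]] in
/-- Same coset, same fibre datum: if `[[g, x], [0, ϖ^m]] K = [[g', x'], [0, ϖ^{m'}]] K` then
`g K_n = g' K_n` and `m = m'`. [folklore] -/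
theorem coe_eq_and_eq_of_coe_blockSuccGL_eq {g g' : GL (Fin n) F} {x x' : Fin n → F} {m m' : ℤ}
    (h : ((blockSuccGL g x (Units.mk0 ϖ hϖ.ne_zero ^ m) : GL (Fin (n + 1)) F) :
        GL (Fin (n + 1)) F ⧸ glInt (n + 1) F) =
      (blockSuccGL g' x' (Units.mk0 ϖ hϖ.ne_zero ^ m') : GL (Fin (n + 1)) F)) :
    ((g : GL (Fin n) F ⧸ glInt n F) = g') ∧ m = m' := by
  rw [QuotientGroup.eq, blockSuccGL_inv_mul_blockSuccGL_mem_glInt_iff hϖ] at h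
  exact ⟨QuotientGroup.eq.2 h.1, h.2.1⟩

omit [IsDiscreteValuationRing 𝒪[F]] in
/-- Same block `g`, same `m`: the cosets of `[[g, x], [0, ϖ^m]]` and `[[g, x'], [0, ϖ^m]]` agree
iff `g⁻¹ (x' - x)` is integral. [folklore] -/
theorem coe_blockSuccGL_eq_iff (g : GL (Fin n) F) (x x' : Fin n → F) (m : ℤ) :
    ((blockSuccGL g x (Units.mk0 ϖ hϖ.ne_zero ^ m) : GL (Fin (n + 1)) F) :
        GL (Fin (n + 1)) F ⧸ glInt (n + 1) F) =
      (blockSuccGL g x' (Units.mk0 ϖ hϖ.ne_zero ^ m) : GL (Fin (n + 1)) F) ↔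
      ∀ i, ((((g⁻¹ : GL (Fin n) F) : Matrix (Fin n) (Fin n) F) *ᵥ (x' - x)) i ∈ 𝒪[F]) := by
  rw [QuotientGroup.eq, blockSuccGL_inv_mul_blockSuccGL_mem_glInt_iff hϖ, inv_mul_cancel]
  exact ⟨fun h => h.2.2, fun h => ⟨Subgroup.one_mem _, rfl, h⟩⟩

omit [ValuativeRel F] [IsDiscreteValuationRing 𝒪[F]] hϖ in
/-- Changing the block by `K_n × K_n`: `[[k₁, 0], [0, 1]] [[g, y], [0, c]] [[k₂, 0], [0, 1]] =
[[k₁ g k₂, k₁ y], [0, c]]`. [folklore] -/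
theorem blockSuccGL_conj (k₁ g k₂ : GL (Fin n) F) (y : Fin n → F) (c : Fˣ) :
    blockSuccGL k₁ 0 1 * blockSuccGL g y c * blockSuccGL k₂ 0 1 =
      blockSuccGL (k₁ * g * k₂) ((k₁ : Matrix (Fin n) (Fin n) F) *ᵥ y) c := by
  rw [blockSuccGL_mul, blockSuccGL_mul, mul_one, one_mul, smul_zero, add_zero, Matrix.mulVec_zero,
    zero_add, Units.val_one, one_smul]

omit [IsDiscreteValuationRing 𝒪[F]] hϖ in
/-- **Every fibre datum is a double coset datum**: if `g' = k₁ g k₂` with `k₁, k₂ ∈ K_n` then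
`[[g', k₁ x], [0, c]]` and `[[g, x], [0, c]]` generate the same `K_{n+1}`-double coset; stated for
any bi-`K_{n+1}`-invariant set `S`. [folklore] -/
theorem blockSuccGL_mem_doubleCoset_iff_of_conj {g k₁ k₂ : GL (Fin n) F} (hk₁ : k₁ ∈ glInt n F)
    (hk₂ : k₂ ∈ glInt n F) (y : Fin n → F) (c : Fˣ) (S : Set (GL (Fin (n + 1)) F))
    (hS : ∀ a ∈ glInt (n + 1) F, ∀ b ∈ glInt (n + 1) F, ∀ z, a * z * b ∈ S ↔ z ∈ S) :
    blockSuccGL (k₁ * g * k₂) ((k₁ : Matrix (Fin n) (Fin n) F) *ᵥ y) c ∈ S ↔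
      blockSuccGL g y c ∈ S := by
  rw [← blockSuccGL_conj]
  exact hS _ (blockSuccGL_zero_one_mem_glInt hk₁) _ (blockSuccGL_zero_one_mem_glInt hk₂) _

end Fibration

end GLBlock

end Literature.NumberTheory.Automorphic
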